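import Literature.AnabelianGeometry.EtaleTheta.SettingModelChiTwistCuspObstruction
import Literature.AnabelianGeometry.EtaleTheta.SettingModelChiCoverings
import Literature.AnabelianGeometry.EtaleTheta.RootsOfUnityGaloisPrimePower
import HarnessLib

/-!
# The χ-twisted carrier `Γ ⋊_{actχ} G_{ℚ_p}` admits NO cusp datum with commutator-axis inertia

Mochizuki, *The étale theta function …*, Publ. RIMS **45** (2009) [EtTh], §1 p. 13 (cusps of `X`, their decomposition
groups `D_x ↠ G_K` and inertia `I_x ≅ Ẑ(1)`); Serre, *Local Fields*, IV §4 Prop. 17 (`Gal(ℚ_p(ζ_{p^k})/ℚ_p) = (ℤ/p^k)^×`).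
Cell abc-iut, layer L2 (NV lane), seat abc-iut-w5-d165 (gen 4); PROOF-ONLY (0 definitions) instantiation of this seat's
`SettingModelChiTwistCuspObstruction` (§6 `not_exists_normalizer_commAxis_onto`) at abc-iut-L2-t1's χ-twisted action
`actχ p = twistGfp ∘ χ` (`SettingModelChiCoverings`), using abc-iut's `exists_levelChar_chi_eq`
(`RootsOfUnityGaloisPrimePower`: every unit of `ℤ/p^k` is a value of `χ_{p^k}` on `G_{ℚ_p}`):

* `exists_chi_ne_one_ne_negOneAut`: some `σ ∈ G_{ℚ_p}` has `χ(σ) ∉ {1, −1}` in `Aut(Ẑ)` (`χ_{p³}(σ) = 1 + p`, and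
  `1 + p ≢ ±1 (mod p³)` for every prime `p`);
* **`actχ_not_exists_normalizer_commAxis_onto`**: in `Γ ⋊_{actχ} G_{ℚ_p}` no subgroup normalising a conjugate
  commutator-axis inertia `inl(g₀ c^Ẑ g₀⁻¹)` surjects onto `G_{ℚ_p}` — so NO `TemperedCurve`/`ThetaSetting` structure on
  this carrier (e.g. `modelχ`, `modelχ′`) has a cusp whose inertia is a conjugate of the commutator axis: the cusp clause
  inhabited at the untwisted `modelκ′` (`SettingModelKrullCuspThm16Origin`) is unreachable here, for EVERY choice of cusp
  (abc-iut-L2-t10's `p433801` refuted it for the chosen toral `b`-axis cusp of `curveχ′`; this is the cusp-free form).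

SEMI-SYNTHETIC carriers = consistency evidence only; nothing here says `IsThm16Origin ∧ IsTateOrigin` is unsatisfiable
in general — only that a joint inhabitant needs a `Δ`-action outside the power-twist family. No side taken on [IUTchIII]
Cor. 3.12; typed ≠ proved.
-/

noncomputable section

namespace Literature.AnabelianGeometry.EtaleTheta.SettingModel

open Literature.AnabelianGeometry.SemiGraphs
open Literature.AnabelianGeometry.AbsoluteAnabelian
open CategoryTheory Function
open scoped commutatorElement

section ChiModel

variable (p : ℕ) [hp : Fact p.Prime]

/-- `1 + p` is a unit of `ℤ/p³ℤ` (inverse `1 − p + p²`). [cite: SerreLocalFields1979, IV §4 Prop 17] -/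
theorem isUnit_one_add_prime_zmod_cube : IsUnit ((1 : ZMod (p ^ 3)) + (p : ZMod (p ^ 3))) := by
  have h3 : ((p : ZMod (p ^ 3))) ^ 3 = 0 := by
    rw [← Nat.cast_pow, ZMod.natCast_self]
  refine IsUnit.of_mul_eq_one (1 - (p : ZMod (p ^ 3)) + (p : ZMod (p ^ 3)) ^ 2) ?_
  have : ((1 : ZMod (p ^ 3)) + p) * (1 - (p : ZMod (p ^ 3)) + (p : ZMod (p ^ 3)) ^ 2) =
      1 + (p : ZMod (p ^ 3)) ^ 3 := by
    ring
  rw [this, h3, add_zero]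

/-- `1 + p ≠ 1` in `ℤ/p³ℤ`. [cite: SerreLocalFields1979, IV §4 Prop 17] -/
theorem one_add_prime_ne_one_zmod_cube : (1 : ZMod (p ^ 3)) + (p : ZMod (p ^ 3)) ≠ 1 := by
  intro h
  have h0 : ((p : ℕ) : ZMod (p ^ 3)) = 0 := by
    have := congrArg (fun x => x - 1) h
    simpa using this
  rw [ZMod.natCast_eq_zero_iff] at h0
  have hle := Nat.le_of_dvd hp.out.pos h0
  have h2 := hp.out.two_le
  have h4 : 2 * p ≤ p ^ 3 := by
    calc 2 * p ≤ p * p := Nat.mul_le_mul_right p h2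
      _ = p ^ 2 := (sq p).symm
      _ ≤ p ^ 3 := Nat.pow_le_pow_right hp.out.pos (by norm_num)
  omega

/-- `1 + p ≠ −1` in `ℤ/p³ℤ` (`p + 2 < p³`). [cite: SerreLocalFields1979, IV §4 Prop 17] -/
theorem one_add_prime_ne_neg_one_zmod_cube : (1 : ZMod (p ^ 3)) + (p : ZMod (p ^ 3)) ≠ -1 := by
  intro h
  have h0 : (((p + 2 : ℕ)) : ZMod (p ^ 3)) = 0 := by
    have := congrArg (fun x => x + 1) h
    simp only [neg_add_cancel] at this
    rw [Nat.cast_add, Nat.cast_two, ← this]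
    ring
  rw [ZMod.natCast_eq_zero_iff] at h0
  have hle := Nat.le_of_dvd (by omega) h0
  have h2 := hp.out.two_le
  have h4 : 4 * p ≤ p ^ 3 := by
    calc 4 * p = 2 * 2 * p := by ring
      _ ≤ p * p * p := Nat.mul_le_mul_right p (Nat.mul_le_mul h2 h2)
      _ = p ^ 3 := by ring
  omega

/-- **Some `σ ∈ G_{ℚ_p}` has cyclotomic character `χ(σ) ∉ {1, −1}`** in `Aut(Ẑ)` (take `χ_{p³}(σ) = 1 + p`, abc-iut's
`exists_levelChar_chi_eq`). [cite: SerreLocalFields1979, IV §4 Prop 17] -/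
theorem exists_chi_ne_one_ne_negOneAut : ∃ σ : GQp p, chi p σ ≠ 1 ∧ chi p σ ≠ ZHatLevel.negOneAut := by
  obtain ⟨σ, hσ⟩ := exists_levelChar_chi_eq p (k := 3) (by norm_num) (isUnit_one_add_prime_zmod_cube p).unit
  rw [IsUnit.unit_spec] at hσ
  refine ⟨σ, fun h1 => ?_, fun h2 => ?_⟩
  · rw [h1, map_one] at hσ
    exact one_add_prime_ne_one_zmod_cube p hσ.symm
  · rw [h2, ZHatLevel.levelChar_negOneAut] at hσ
    exact one_add_prime_ne_neg_one_zmod_cube p hσ.symm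

/-- **At the χ-twisted carrier `Π^tp_X = Γ ⋊_{actχ} G_{ℚ_p}` (abc-iut-L2-t1's `actχ = twistGfp ∘ χ`, the `Δ`-side of
`modelχ` / `modelχ′` and their relatives) NO subgroup normalising a conjugate commutator-axis inertia
`inl(g₀ c^Ẑ g₀⁻¹)` surjects onto `G_{ℚ_p}`** — so no cusp datum of any `TemperedCurve` structure on this carrier
has commutator-axis inertia (clauses «`I_x ⊲ D_x`» + (P4) «`aug(D_x) = G_K`»), whatever the cusp.
[cite: MochizukiEtTh2009, §1 p.13] -/
theorem actχ_not_exists_normalizer_commAxis_onto (g₀ : Gfp) :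
    ¬ ∃ D : Subgroup (Gfp ⋊[actχ p] GQp p), D ≤ Subgroup.normalizer
      ((((cAxisGfp.map (MulAut.conj g₀).toMonoidHom).map
        (SemidirectProduct.inl : Gfp →* Gfp ⋊[actχ p] GQp p)) : Subgroup (Gfp ⋊[actχ p] GQp p)) :
          Set (Gfp ⋊[actχ p] GQp p)) ∧ ∀ σ : GQp p, ∃ d ∈ D, d.right = σ := by
  obtain ⟨σ₀, h1, h2⟩ := exists_chi_ne_one_ne_negOneAut p
  exact not_exists_normalizer_commAxis_onto (actχ p) (chi p) (fun σ q => rfl) h1 h2 g₀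

/-- Equivalently, positively phrased: in `Γ ⋊_{actχ} G_{ℚ_p}` every subgroup normalising a conjugate commutator-axis
inertia MISSES some fibre of `aug` — its image in `G_{ℚ_p}` is a proper subset. [cite: MochizukiEtTh2009, §1 p.13] -/
theorem actχ_exists_right_ne_of_le_normalizer_commAxis (g₀ : Gfp) (D : Subgroup (Gfp ⋊[actχ p] GQp p))
    (hD : D ≤ Subgroup.normalizer ((((cAxisGfp.map (MulAut.conj g₀).toMonoidHom).map
      (SemidirectProduct.inl : Gfp →* Gfp ⋊[actχ p] GQp p)) : Subgroup (Gfp ⋊[actχ p] GQp p)) :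
        Set (Gfp ⋊[actχ p] GQp p))) :
    ∃ σ : GQp p, ∀ d ∈ D, d.right ≠ σ := by
  by_contra h
  simp only [not_exists, not_forall, not_not] at h
  exact actχ_not_exists_normalizer_commAxis_onto p g₀ ⟨D, hD, fun σ => (h σ).imp fun d hd => ⟨hd.1, hd.2⟩⟩

end ChiModel

end Literature.AnabelianGeometry.EtaleTheta.SettingModel

end
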